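import Literature.MathematicalPhysics.QuantumFieldTheory.Balaban1983to89.Node00.HistoryTermDatum214
import Literature.MathematicalPhysics.QuantumFieldTheory.Balaban1983to89.B13Term214WindowDilatedConfig
import Literature.Analysis.Complex.HolomorphicBanach

/-!
# BalabanUVNodes ∕ node N22 = NE9 — THE RELATIVE-DISC CENTRED ROAD OVER THE ADMISSIBLE CLASS, MODULE J11: THE WINDOW-DILATED MEMBER OF THE DATUM AND ITS COUPLING-BLIND CENTRE ARE
# ANALYTIC IN THE CONFIGURATION, FROM PRIMITIVE φ-HOLOMORPHY LAWS ON AN OPEN THICKENING — the two φ-analyticity located inputs `hMan` ∕ `hVan` of J10-D's record `SliceInputsLG` made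
# CONSEQUENCES of print's primitive laws ([II] p. 15 ll. 19–20 «We consider it as an analytic function of (𝐔, 𝐉) in the space 𝐔^c_{k+1}(X, α₀, α₁)»; (1.5) p. 3; (1.41) p. 11; [I] p. 263)

Cell `pub-ymgap`, HUMAN RULING D-0062 (Track A), R134 ACCELERATION re-seat `pub-ymgap-dag-n22-c` (strategy s1 «direct first-missing estimate»), generation 9, file J11.  THEOREMS ONLY;
imports node00-def-W1's W1-7 `Node00/HistoryTermDatum214` (the (2.14) term datum), this seat's Literature module `B13Term214WindowDilatedConfig` (J11-L: the configuration direction of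
the window-dilated (2.14) term from primitive letters, local-growth edition) and `Literature/Analysis/Complex/HolomorphicBanach` ([Chae1985] Thm 14.13: Fréchet-holomorphic on an open set
of a complex normed space ⟹ analytic at each of its points) BY NAME.  `--supports` K3⁷ `SpineGivenEndpointR13SepCoPH` (stmt-QuantumFields-20544) as a helper.

WHY.  The admissible-history edition of the s1 line (modules A0, R1aᴬ∕R1bᴬ, R2ᴬ, J2ᴬ, J10-D∕J10a∕J10b∕J10c) carries the heredity of «(1.18)-bounded AND ANALYTIC on the tables of record»
([I] p. 263; node00-def-W1 W1-13 `W1.AdmHist`; dag-n18-c's class): to hand the NEXT level its guard, every slice must know that the new term — the window-dilated MEMBER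
`(2.14)_b[old, ψ]` of base point `s₀` and its coupling-blind CENTRE — is analytic in the configuration `ψ` at the point `φ` of the table.  J10-D records this as two located inputs,
`SliceInputsLG.hMan` and `SliceInputsLG.hVan` (:430 ∕ :436) — INTEGRAL-level statements (analyticity of an iterated `∫₀¹ds ∮dσ ∫₀¹dt ∮dτ ∫dμ` of Gaussian means), the only two of the
record.  Print asserts them as a TYPE ([II] p. 15 ll. 19–20) — holomorphy under the integral signs, from the analyticity of the basic operators in the background field ((1.5) p. 3,
NODE A) and of the older terms on their spaces ([I] p. 263, the inductive assumption, entering through 𝐕_k by (1.41)).  THIS FILE proves exactly the two conclusions from exactly those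
primitive laws, stated on an OPEN set `W ∋ φ` of the ambient configuration space `Φ = Sect2.CPair P 𝔸` (print's «constants α′₀, α′₁ much bigger than α₀, α₁»; the table of record
itself is NOT open in `Φ` — dag-n18-c `…N18HLayerW1SpaceNotOpen` — so the thickening is the producer's to name) carrying J10a's located letters UNIFORMLY on `W`:
* §1 ★ `analyticOnNhd_memberOfDatum_config_of_localGrowth` — for the member: J10a §1's located inputs (regions, boxes with (2.22) at `s₀`, NODE A's kernel letters, W1-12's LOCAL growth
  letters (L0) (ℓ1) (L4) of the coupling-free potentials `𝒲(ψ;Y,·)`, `𝒪(old,ψ;Y,·)`, bond supports, per-bond multiplicity, box-support law, `Y`-locality, primed letters, numerics of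
  the holomorphy half) asked AT EVERY `ψ ∈ W` with ONE set of constants, PLUS the four primitive φ-laws: `ψ ↦ 𝔇.A Z t ψ σ i j` and `ψ ↦ (𝔇.𝒦 Z t).G2 σ (𝔇.uOf Z t ψ) i j` complex
  differentiable on `W` at each `σ` of the polydisc ((1.5) p. 3 read through `uOf`, p. 15 «U = U′U»), `ψ ↦ 𝒲 Z t ψ Y A` and `ψ ↦ 𝒪 Z t old ψ Y A` complex differentiable on `W` at each
  `(Y, A)` ((1.41) + [I] p. 263 — under the law of the potentials this is the analytic conjunct of `old ∈ W1.AdmHist`, which is why the record asks `hMan` only at admissible histories);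
  conclusion `AnalyticOnNhd ℂ (ψ ↦ (2.14)_b[old, ψ]) W` for every member `b` of the ball — J11-L §2 + [Chae1985]; its value `… φ hφ` at a point `φ ∈ W` is LITERALLY the
  consequent of `SliceInputsLG.hMan old _ b hb` (checked by `rfl` on the two proof terms before filing).
* §2 ★ `analyticOnNhd_centreOfDatum_config_of_primitives` — for the centre `term(A(ψ), Γ(ψ), F214 |P| 1 1 𝐃 (Y ↦ 𝒪(old, ψ; Y, 0)))` (`P(t) = ∅`; J7a §2 ∕ J8): J8's located inputs
  at every `ψ ∈ W` (incl. `Re A(ψ,σ) ≻ 0` displayed, as there) plus the kernel φ-laws and `ψ ↦ 𝒪 Z t old ψ Y 0` complex differentiable on `W`; ONE application of dag-n10-c's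
  `B13Term214ParamHolo.differentiableOn_term214_torus_param_of_primitives_holo_polyτ` (v1.1 §7, kernels and potentials parametrised; field-constant potential, boxes ≡ 1, (2.22) free at
  `|P(t)| = 0`) + [Chae1985]; its value at `φ ∈ W` is LITERALLY the consequent of `SliceInputsLG.hVan old _ hP` (checked by `rfl`).

HONEST FRAMING — what this is NOT.  Count-neutral kernel-keyed readings (holomorphy under the integral sign = the tree's generic (2.14) devices; Banach-space «holomorphic ⟹ analytic»
= [Chae1985]); no estimate of Bałaban's proved here.  Every located input is a HYPOTHESIS about the datum — NODE A's kernel letters and kernel φ-laws, W1-12's local growth letters,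
the φ-laws of `𝒲` ∕ `𝒪` (the definers' ∕ N09's ∕ N10's business), the open thickening `W` itself; nothing of Bałaban's asserted; the record `SliceInputsLG` is NOT edited here (its
`hMan`∕`hVan` fields stay; this file is what a producer instantiates them with); N22 NOT discharged (typed 28∕28 · discharged 5∕27 UNCHANGED); one finite four-torus programme at fixed
ε — NOT infinite volume, NOT OS on ℝ⁴, NOT a mass gap, NOT Clay.  0 `sorry`, 0 `def`, standard axioms.

References (TYPES ∕ loci only): [II] = [Balaban1988RG2Cluster] (1.5) p. 3, (1.34)–(1.36) p. 9, Lemma 2 (1.41)–(1.43) p. 11, (2.2)–(2.3) p. 12, (2.14)–(2.15) p. 15 (ll. 19–20),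
(2.16)–(2.22) p. 16, (2.23)–(2.26) p. 17; [I] = [Balaban1987RG1] §1 p. 263 ll. 22–26, (2.9)–(2.13) pp. 266–268; [Chae1985] S. B. Chae, *Holomorphy and Calculus in Normed Spaces*,
Thm 14.13.
-/

noncomputable section

namespace YMDAG.N22.W1

open Set Metric Matrix
open Literature.MathematicalPhysics.QuantumFieldTheory.Balaban1983to89
open Literature.MathematicalPhysics.QuantumFieldTheory.Balaban1983to89.B13Term214 (term214 core214 F214)
open Literature.MathematicalPhysics.QuantumFieldTheory.Balaban1983to89.B13Term214WindowDilatedConfig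
  (differentiableOn_term214_torus_windowDilated_config_of_localGrowth_perBond)
open Literature.MathematicalPhysics.QuantumFieldTheory.Balaban1983to89.B13Term214ParamHolo (differentiableOn_term214_torus_param_of_primitives_holo_polyτ)
open Literature.MathematicalPhysics.QuantumFieldTheory.Balaban1983to89.TreeLengthTorus (TPt TDom tsys)
open Literature.MathematicalPhysics.QuantumFieldTheory.Balaban1983to89.B9Thm37GlueTorus (tdist1)
open Literature.MathematicalPhysics.QuantumFieldTheory.Balaban1983to89.B5TorusCover (UT)
open Literature.MathematicalPhysics.QuantumFieldTheory.Balaban1983to89.Node00.Sect2 (domSys domCount CPair)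
open Literature.MathematicalPhysics.QuantumFieldTheory.Balaban1983to89.Node00.W1
open Literature.Analysis.Complex.HolomorphicBanach (analyticOnNhd_of_differentiableOn)

variable {c₀ : B13.Consts} {P : Params} {𝔸 : Type*} [NormedRing 𝔸] [NormedAlgebra ℂ 𝔸] {M k L : ℕ} [NeZero L] (𝔇 : TermDatum214 c₀ P 𝔸 M k L)
  (χu χcu : (Z : (domSys P M (k + 1)).Dom) → (t : TermLabel P M k L) → ((𝔇.𝒦 Z t).Λ → ℝ) → ℝ)
  (𝒲 : (Z : (domSys P M (k + 1)).Dom) → (t : TermLabel P M k L) → CPair P 𝔸 → TDom P.d (L * domCount P M (k + 1)) → ((𝔇.𝒦 Z t).Λ → ℝ) → ℂ)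
  (𝒪 : (Z : (domSys P M (k + 1)).Dom) → (t : TermLabel P M k L) → OlderTerms P 𝔸 M k → CPair P 𝔸 → TDom P.d (L * domCount P M (k + 1)) →
    ((𝔇.𝒦 Z t).Λ → ℝ) → ℂ)

/-! ## §1 The window-dilated member of the datum is analytic in the configuration on an open thickening, from LOCAL growth letters uniform there and the primitive φ-laws -/

open Classical in
/-- **THE WINDOW-DILATED MEMBER OF THE DATUM IS ANALYTIC IN THE CONFIGURATION** ([II] p. 15 ll. 19–20 for the member `b` of base point `s₀` of the term `(Z, t)` at the history `old`) —
on an OPEN set `W` of `Φ = Sect2.CPair P 𝔸`: J10a §1's located inputs of the holomorphy half (regions `Uσ, Uτ` and radii, the unscaled-field boxes at `s₀` with (2.22), NODE A's kernel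
letters (L17a)∕(L16a) for `A(ψ,σ)`, `G(σ, uOf ψ)` on the open σ-polydisc, the references `Γ₀, C ≻ 0, K_E`, W1-12's LOCAL growth letters (L0) (ℓ1) (L4) of the coupling-free potentials
on the sup-ball `‖A‖ ≤ ρ`, bond supports, the per-bond multiplicity `m₃`, the box-support law at `s₀`, the `Y`-locality in `S₀`, the primed letters, the capstone's numeric conditions)
asked AT EVERY `ψ ∈ W` with one set of constants, PLUS the primitive φ-laws: entrywise `ψ ↦ 𝔇.A Z t ψ σ`, `ψ ↦ (𝔇.𝒦 Z t).G2 σ (𝔇.uOf Z t ψ)` complex differentiable on `W` at each `σ`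
of the polydisc ((1.5) p. 3), `ψ ↦ 𝒲 Z t ψ Y A`, `ψ ↦ 𝒪 Z t old ψ Y A` complex differentiable on `W` at each `(Y, A)` ((1.41) p. 11, [I] p. 263).  Conclusion: for every member `b`
of the ball, `ψ ↦ (2.14)_b[old, ψ]` is ANALYTIC on `W` (at each point, in a `Φ`-neighbourhood).  Proof: J11-L §2 `differentiableOn_term214_torus_windowDilated_config_of_localGrowth_perBond`
at the datum (Γ-kernel `G(σ) := (𝒦 Z t).G2 σ (uOf ψ)`, `hlin` by `rfl`, references and locations READ OFF NODE A's kernel record), then [Chae1985] Thm 14.13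
(`HolomorphicBanach.analyticOnNhd_of_differentiableOn`).  No estimate proved here.
[cite: Balaban1988RG2Cluster, (2.14)-(2.15) p.15, (1.5) p.3, (1.41)-(1.42) p.11, (2.2)-(2.3) p.12, (2.16)-(2.22) p.16, (2.23)-(2.25) p.17; Balaban1987RG1, §1 p.263, (2.9)-(2.13) pp.266-268; Chae1985, Thm 14.13] -/
theorem analyticOnNhd_memberOfDatum_config_of_localGrowth
    (Z : (domSys P M (k + 1)).Dom) (t : TermLabel P M k L) (old : OlderTerms P 𝔸 M k) (s₀ : ℝ)
    -- the open thickening of the configuration table on which the laws and letters hold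
    {W : Set (CPair P 𝔸)} (hW : IsOpen W)
    (c : B13.Consts)
    {Uσ : Set ℂ}
    {Uτ : TDom P.d (L * domCount P M (k + 1)) → Set ℂ}
    (hUσ : IsOpen Uσ)
    (hUτ : ∀ Y, IsOpen (Uτ Y))
    (hUexp : closedBall (0 : ℂ) (Real.exp c.κ₁) ⊆ Uσ)
    (hr : 0 < 𝔇.r)
    (hr' : 𝔇.r ≤ Real.exp c.κ₁ - 1)
    (hsubτ : ∀ Y, ∀ s ∈ Set.uIcc (0 : ℝ) 1, closedBall (s : ℂ) 𝔇.r ⊆ Uτ Y)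
    -- the unscaled-field boxes at the base point (configuration-free)
    (hχ0 : ∀ B, 0 ≤ χu Z t (s₀ • B))
    (hχc0 : ∀ B, 0 ≤ χcu Z t (s₀ • B))
    {ρ : ℝ}
    (hs : 0 < s₀)
    (hρ : 0 ≤ ρ)
    -- THE PRIMITIVE φ-LAWS OF THE KERNELS ((1.5) p. 3): σ-holomorphy at each configuration of `W`, φ-holomorphy on `W` at each σ of the polydisc
    (hAhol : ∀ ψ ∈ W, ∀ i j, DifferentiableOn ℂ (fun σ => 𝔇.A Z t ψ σ i j) {σ | ∀ j, σ j ∈ Uσ})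
    (hAd : ∀ σ : TPt P.d (domCount P M (k + 1)) → ℂ, (∀ j, σ j ∈ Uσ) → ∀ i j, DifferentiableOn ℂ (fun ψ => 𝔇.A Z t ψ σ i j) W)
    (hχm : Measurable fun B : (𝔇.𝒦 Z t).Λ → ℝ => χu Z t (s₀ • B))
    (hχcm : Measurable fun B : (𝔇.𝒦 Z t).Λ → ℝ => χcu Z t (s₀ • B))
    -- THE PRIMITIVE φ-LAWS OF THE POTENTIALS ((1.41) p. 11; [I] p. 263): measurable in the field at each configuration, φ-holomorphic on `W` at each (Y, A)
    (h𝒲m : ∀ ψ ∈ W, ∀ Y, Measurable (𝒲 Z t ψ Y))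
    (h𝒲d : ∀ Y A, DifferentiableOn ℂ (fun ψ => 𝒲 Z t ψ Y A) W)
    (h𝒪m : ∀ ψ ∈ W, ∀ Y, Measurable (𝒪 Z t old ψ Y))
    (h𝒪d : ∀ Y A, DifferentiableOn ℂ (fun ψ => 𝒪 Z t old ψ Y A) W)
    (hAs : ∀ ψ ∈ W, ∀ σ : TPt P.d (domCount P M (k + 1)) → ℂ, (∀ j, σ j ∈ Uσ) → (𝔇.A Z t ψ σ).IsSymm)
    (hGhol : ∀ ψ ∈ W, ∀ i j, DifferentiableOn ℂ (fun σ => (𝔇.𝒦 Z t).G2 σ (𝔇.uOf Z t ψ) i j) {σ | ∀ j, σ j ∈ Uσ})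
    (hGd : ∀ σ : TPt P.d (domCount P M (k + 1)) → ℂ, (∀ j, σ j ∈ Uσ) → ∀ i j, DifferentiableOn ℂ (fun ψ => (𝔇.𝒦 Z t).G2 σ (𝔇.uOf Z t ψ) i j) W)
    -- the (2.22) shape of the boxes at the base point
    {γ₂ rP : ℝ}
    (qP : ((𝔇.𝒦 Z t).Λ → ℝ) → ℝ)
    (h222 : ∀ B : (𝔇.𝒦 Z t).Λ → ℝ, χu Z t (s₀ • B) * χcu Z t (s₀ • B) ≤ Real.exp (-(γ₂ / 2 * rP ^ 2 * (t.2.card : ℕ)) + γ₂ / 2 * qP B))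
    (hγ₂ : 0 ≤ γ₂)
    (hqP : ∀ B, qP B ≤ B ⬝ᵥ B)
    -- W1-12's LOCAL growth letters of the coupling-free potentials, UNIFORM on `W`: per-domain τ-radii, (L0), (ℓ1), (L4) on the sup-ball, bond supports, per-bond multiplicity,
    -- the box-support law at the base point, `Y`-locality in `S₀`
    {R cz c₁ c₃ : TDom P.d (L * domCount P M (k + 1)) → ℝ}
    (hR : ∀ Y ∈ t.1, 0 ≤ R Y)
    (hc₃ : ∀ Y ∈ t.1, 0 ≤ c₃ Y)
    (hc₁ : ∀ Y ∈ t.1, 0 ≤ c₁ Y)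
    (hUτR : ∀ Y ∈ t.1, ∀ z ∈ Uτ Y, ‖z‖ ≤ R Y)
    (h0 : ∀ ψ ∈ W, ∀ Y ∈ t.1, ‖𝒪 Z t old ψ Y 0‖ ≤ cz Y)
    (S : TDom P.d (L * domCount P M (k + 1)) → Finset (𝔇.𝒦 Z t).Λ)
    (h1loc : ∀ ψ ∈ W, ∀ Y ∈ t.1, ∀ A : (𝔇.𝒦 Z t).Λ → ℝ, ‖A‖ ≤ ρ → ‖𝒲 Z t ψ Y A‖ ≤ c₃ Y * ‖A‖ * ∑ b ∈ S Y, A b ^ 2)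
    (h4 : ∀ ψ ∈ W, ∀ Y ∈ t.1, ∀ A : (𝔇.𝒦 Z t).Λ → ℝ, ‖A‖ ≤ ρ → ‖𝒪 Z t old ψ Y A - 𝒪 Z t old ψ Y 0‖ ≤ c₁ Y * ‖A‖)
    {m₃ : ℝ}
    (hm₃0 : 0 ≤ m₃)
    (hm₃ : ∀ bd : (𝔇.𝒦 Z t).Λ, ∑ Y ∈ t.1 with bd ∈ S Y, R Y * c₃ Y ≤ m₃)
    (S₀ : Set (𝔇.𝒦 Z t).Λ)
    (hbox : ∀ B : (𝔇.𝒦 Z t).Λ → ℝ, χu Z t (s₀ • B) ≠ 0 → ∀ b ∈ S₀, |(s₀ • B) b| ≤ ρ)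
    (hloc𝒲 : ∀ ψ ∈ W, ∀ Y ∈ t.1, ∀ A A' : (𝔇.𝒦 Z t).Λ → ℝ, (∀ b ∈ S₀, A b = A' b) → 𝒲 Z t ψ Y A = 𝒲 Z t ψ Y A')
    (hloc𝒪 : ∀ ψ ∈ W, ∀ Y ∈ t.1, ∀ A A' : (𝔇.𝒦 Z t).Λ → ℝ, (∀ b ∈ S₀, A b = A' b) → 𝒪 Z t old ψ Y A = 𝒪 Z t old ψ Y A')
    -- bonds located on the torus `UT Nf`
    (hfibN : ∀ x : UT 𝔇.Nf, (Finset.univ.filter fun j => (𝔇.𝒦 Z t).locN j = x).card ≤ (𝔇.𝒦 Z t).m)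
    -- rates and NODE A's kernel letters at b = 1 (+ K_E), UNIFORM on `W`
    {kap kap' kap'' θ θE θΓ θC KG KΓ KCs K₀ KE : ℝ}
    (hkap'' : 0 < kap'')
    (h1 : kap'' < kap')
    (h2 : kap' < kap)
    (hθE : 0 ≤ θE)
    (hθΓ : 0 ≤ θΓ)
    (hθC : 0 ≤ θC)
    (hKG : 0 ≤ KG)
    (hKΓ : 0 ≤ KΓ)
    (hKCs : 0 ≤ KCs)
    (hK₀ : 0 ≤ K₀)
    (hKE : 0 ≤ KE)
    (hG : ∀ ψ ∈ W, ∀ σ : TPt P.d (domCount P M (k + 1)) → ℂ, (∀ j, σ j ∈ Uσ) →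
      ∀ b j, ‖(𝔇.𝒦 Z t).G2 σ (𝔇.uOf Z t ψ) b j‖ ≤ KG * Real.exp (-(kap * tdist1 𝔇.Nf ((𝔇.𝒦 Z t).locΛ b) ((𝔇.𝒦 Z t).locN j))))
    (hΓ₀ : ∀ b j, ‖(𝔇.𝒦 Z t).Γ₀ b j‖ ≤ KΓ * Real.exp (-(kap * tdist1 𝔇.Nf ((𝔇.𝒦 Z t).locΛ b) ((𝔇.𝒦 Z t).locN j))))
    (hCs : ∀ ψ ∈ W, ∀ σ : TPt P.d (domCount P M (k + 1)) → ℂ, (∀ j, σ j ∈ Uσ) →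
      ∀ b b', ‖(𝔇.A Z t ψ σ)⁻¹ b b'‖ ≤ KCs * Real.exp (-(kap * tdist1 𝔇.Nf ((𝔇.𝒦 Z t).locΛ b) ((𝔇.𝒦 Z t).locΛ b'))))
    (hC216 : ∀ b b', ‖(𝔇.𝒦 Z t).C b b'‖ ≤ K₀ * Real.exp (-(kap * tdist1 𝔇.Nf ((𝔇.𝒦 Z t).locΛ b) ((𝔇.𝒦 Z t).locΛ b'))))
    (hCE : ∀ b b', ‖((𝔇.𝒦 Z t).C⁻¹.map (algebraMap ℝ ℂ)) b b'‖ ≤ KE * Real.exp (-(kap * tdist1 𝔇.Nf ((𝔇.𝒦 Z t).locΛ b) ((𝔇.𝒦 Z t).locΛ b'))))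
    (hdΓ : ∀ ψ ∈ W, ∀ σ : TPt P.d (domCount P M (k + 1)) → ℂ, (∀ j, σ j ∈ Uσ) →
      ∀ b j, ‖((𝔇.𝒦 Z t).G2 σ (𝔇.uOf Z t ψ) - (𝔇.𝒦 Z t).Γ₀.map (algebraMap ℝ ℂ)) b j‖ ≤ θΓ * Real.exp (-(kap * tdist1 𝔇.Nf ((𝔇.𝒦 Z t).locΛ b) ((𝔇.𝒦 Z t).locN j))))
    (hdC : ∀ ψ ∈ W, ∀ σ : TPt P.d (domCount P M (k + 1)) → ℂ, (∀ j, σ j ∈ Uσ) →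
      ∀ b b', ‖((𝔇.A Z t ψ σ)⁻¹ - (𝔇.𝒦 Z t).C.map (algebraMap ℝ ℂ)) b b'‖
        ≤ θC * Real.exp (-(kap * tdist1 𝔇.Nf ((𝔇.𝒦 Z t).locΛ b) ((𝔇.𝒦 Z t).locΛ b'))))
    (hdE : ∀ ψ ∈ W, ∀ σ : TPt P.d (domCount P M (k + 1)) → ℂ, (∀ j, σ j ∈ Uσ) →
      ∀ b b', ‖(𝔇.A Z t ψ σ - (𝔇.𝒦 Z t).C⁻¹.map (algebraMap ℝ ℂ)) b b'‖ ≤ θE * Real.exp (-(kap * tdist1 𝔇.Nf ((𝔇.𝒦 Z t).locΛ b) ((𝔇.𝒦 Z t).locΛ b'))))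
    -- the radius of the ball in `b` and the PRIMED letters dominating the transports
    {ρb KG' KCs' θΓ' θC' θE' a' w' : ℝ}
    (hρb1 : ρb < 1)
    (hKG' : (1 + ρb) * KG ≤ KG')
    (hKCs' : ((1 - ρb) ^ 2)⁻¹ * KCs ≤ KCs')
    (hθΓ' : θΓ + ρb * KG ≤ θΓ')
    (hθC' : θC + ρb * (2 + ρb) * ((1 - ρb) ^ 2)⁻¹ * KCs ≤ θC')
    (hθE' : θE + ρb * (2 + ρb) * (θE + KE) ≤ θE')
    (ha' : (1 + ρb) ^ 2 * (2 * ρ * m₃) ≤ a')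
    (hw' : (1 + ρb) ^ 2 * (∑ Y ∈ t.1, R Y * (cz Y + c₁ Y * ρ)) ≤ w')
    -- the capstone's numeric conditions in the primed letters (those of the holomorphy half)
    (hθEle : θE' ≤ θ)
    (hθΓle : θΓ' ≤ θ)
    (hθR1le : ((𝔇.𝒦 Z t).m * (1 + 2 / (kap - kap')) ^ 𝔇.ν) * ((𝔇.𝒦 Z t).m * (1 + 2 / (kap' - kap'')) ^ 𝔇.ν)
      * (θΓ' * KCs' * KG' + KΓ * θC' * KG' + KΓ * K₀ * θΓ') ≤ θ)
    (hsmallKθ : K₀ * ((𝔇.𝒦 Z t).m * (1 + 2 / kap) ^ 𝔇.ν) * (θ * ((𝔇.𝒦 Z t).m * (1 + 2 / kap'') ^ 𝔇.ν)) < 1)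
    {cE g : ℝ}
    (hc0 : 0 ≤ cE)
    (hc : ∀ k, (𝔇.𝒦 Z t).hC.1.eigenvalues k ≤ cE)
    (hαc : (2 * (θ * ((𝔇.𝒦 Z t).m * (1 + 2 / kap'') ^ 𝔇.ν)) + (γ₂ + a')) * cE ≤ 1 / 2)
    (hΓq : ∀ X : (𝔇.𝒦 Z t).Λ ⊕ (𝔇.𝒦 Z t).C₀ → ℝ, ((𝔇.𝒦 Z t).Γ₀ *ᵥ X) ⬝ᵥ ((𝔇.𝒦 Z t).C *ᵥ ((𝔇.𝒦 Z t).Γ₀ *ᵥ X)) ≤ g * (X ⬝ᵥ X))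
    (hsmall : (2 * (θ * ((𝔇.𝒦 Z t).m * (1 + 2 / kap'') ^ 𝔇.ν)) + (γ₂ + a')) * (1 + 2 * cE * g) ≤ 1 / 2)
    {b : ℂ} (hb : b ∈ ball (1 : ℂ) ρb) :
    AnalyticOnNhd ℂ (fun ψ : CPair P 𝔸 => term214 𝔇.r (sigmaList L Z t) (tauList P M k L t)
        (core214 (fun σ => b ^ 2 • 𝔇.A Z t ψ σ) (fun σ X => b • 𝔇.Gam Z t ψ σ X)
          (F214 t.2.card (fun B => χu Z t (s₀ • B)) (fun B => χcu Z t (s₀ • B)) t.1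
            (fun Y B => b ^ 2 * ((((s₀ : ℝ) : ℂ) ^ 2)⁻¹ * 𝒲 Z t ψ Y (s₀ • B)) + 𝒪 Z t old ψ Y (s₀ • B)))) 0 0) W :=
  analyticOnNhd_of_differentiableOn
    (differentiableOn_term214_torus_windowDilated_config_of_localGrowth_perBond c hW hUσ hUτ hUexp hr hr' hsubτ (lZ := sigmaList L Z t)
      (sigmaList_spec Z t).1 (lD := tauList P M k L t) (tauList_spec t).1 (fun ψ σ => 𝔇.A Z t ψ σ) (fun ψ σ X => 𝔇.Gam Z t ψ σ X) t.2.card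
      (fun B => χu Z t (s₀ • B)) (fun B => χcu Z t (s₀ • B)) hχ0 hχc0 t.1 (fun ψ Y => 𝒲 Z t ψ Y) (fun ψ Y => 𝒪 Z t old ψ Y) (s := s₀) hs hρ
      (𝔇.𝒦 Z t).hC (𝔇.𝒦 Z t).Γ₀ hAhol hAd hχm hχcm h𝒲m h𝒲d h𝒪m h𝒪d hAs (fun ψ σ => (𝔇.𝒦 Z t).G2 σ (𝔇.uOf Z t ψ)) hGhol hGd
      (fun _ _ _ _ _ => rfl) qP h222 hγ₂ hqP hR hc₃ hc₁ hUτR h0 S h1loc h4 hm₃0 hm₃ S₀ hbox hloc𝒲 hloc𝒪 (𝔇.𝒦 Z t).locΛ (𝔇.𝒦 Z t).locN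
      (𝔇.𝒦 Z t).hfib hfibN hkap'' h1 h2 hθE hθΓ hθC hKG hKΓ hKCs hK₀ hKE hG hΓ₀ hCs hC216 hCE hdΓ hdC hdE hρb1 hKG' hKCs' hθΓ' hθC' hθE' ha' hw'
      hθEle hθΓle hθR1le hsmallKθ hc0 hc hαc hΓq hsmall hb)
    hW

/-! ## §2 The coupling-blind centre of the datum (`P(t) = ∅`) is analytic in the configuration on an open thickening, UNdilated engine with the kernels parametrised -/

open Classical in
/-- **THE COUPLING-BLIND CENTRE OF THE DATUM IS ANALYTIC IN THE CONFIGURATION** ([II] p. 15 ll. 19–20 for the centre of J7a §2 ∕ J8,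
`V(old, ψ) := term(A(ψ), Γ(ψ), F214 |P| 1 1 𝐃 (Y ↦ 𝒪(old, ψ; Y, 0)))`, a term WITHOUT large-field boxes: `|P(t)| = 0`) — on an OPEN set `W` of `Φ`: J8's located inputs of the holomorphy
half asked AT EVERY `ψ ∈ W` with one set of constants (regions and radii, NODE A's kernel letters for `A(ψ,σ)`, `G(σ, uOf ψ)` on the open σ-polydisc incl. `Re A(ψ,σ) ≻ 0` displayed as
in J8, references, the capstone's numeric conditions with the centre's (2.20)-type letter `Σ|τ||𝒪(old, ψ; Y, 0)| ≤ ½a₂₀‖B‖² + w` on the τ-region), PLUS the primitive φ-laws: entrywise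
`ψ ↦ 𝔇.A Z t ψ σ`, `ψ ↦ (𝔇.𝒦 Z t).G2 σ (𝔇.uOf Z t ψ)` complex differentiable on `W` at each `σ` of the polydisc ((1.5) p. 3) and `ψ ↦ 𝒪 Z t old ψ Y 0` complex differentiable on `W`
at each `Y` ((1.41) p. 11, [I] p. 263).  Conclusion: `ψ ↦ V(old, ψ)` is ANALYTIC on `W`.  Proof: ONE application of dag-n10-c's
`B13Term214ParamHolo.differentiableOn_term214_torus_param_of_primitives_holo_polyτ` (v1.1 §7: kernels AND potentials parametrised; the potential field-constant, boxes ≡ 1, (2.22)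
free at `|P(t)| = 0` for any `γ₂ ≥ 0`, `r_P`), then [Chae1985] Thm 14.13.  No estimate proved here.
[cite: Balaban1988RG2Cluster, (2.14)-(2.15) p.15, (1.5) p.3, (1.41) p.11, (2.16)-(2.22) p.16, (2.23)-(2.25) p.17; Balaban1987RG1, §1 p.263, (2.12)-(2.13) p.268; Chae1985, Thm 14.13] -/
theorem analyticOnNhd_centreOfDatum_config_of_primitives
    (Z : (domSys P M (k + 1)).Dom) (t : TermLabel P M k L) (old : OlderTerms P 𝔸 M k) (hP0 : t.2.card = 0)
    -- the open thickening of the configuration table on which the laws and letters hold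
    {W : Set (CPair P 𝔸)} (hW : IsOpen W)
    (c : B13.Consts)
    {Uσ : Set ℂ}
    {Uτ : TDom P.d (L * domCount P M (k + 1)) → Set ℂ}
    (hUσ : IsOpen Uσ)
    (hUτ : ∀ Y, IsOpen (Uτ Y))
    (hUexp : closedBall (0 : ℂ) (Real.exp c.κ₁) ⊆ Uσ)
    (hr : 0 < 𝔇.r)
    (hr' : 𝔇.r ≤ Real.exp c.κ₁ - 1)
    (hsubτ : ∀ Y, ∀ s ∈ Set.uIcc (0 : ℝ) 1, closedBall (s : ℂ) 𝔇.r ⊆ Uτ Y)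
    -- THE PRIMITIVE φ-LAWS OF THE KERNELS ((1.5) p. 3): σ-holomorphy at each configuration of `W`, φ-holomorphy on `W` at each σ of the polydisc; symmetry and `Re ≻ 0` at each ψ
    (hAhol : ∀ ψ ∈ W, ∀ i j, DifferentiableOn ℂ (fun σ => 𝔇.A Z t ψ σ i j) {σ | ∀ j, σ j ∈ Uσ})
    (hAd : ∀ σ : TPt P.d (domCount P M (k + 1)) → ℂ, (∀ j, σ j ∈ Uσ) → ∀ i j, DifferentiableOn ℂ (fun ψ => 𝔇.A Z t ψ σ i j) W)
    (hAs : ∀ ψ ∈ W, ∀ σ : TPt P.d (domCount P M (k + 1)) → ℂ, (∀ j, σ j ∈ Uσ) → (𝔇.A Z t ψ σ).IsSymm)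
    (hA : ∀ ψ ∈ W, ∀ σ : TPt P.d (domCount P M (k + 1)) → ℂ, (∀ j, σ j ∈ Uσ) → ((𝔇.A Z t ψ σ).map Complex.re).PosDef)
    (hGhol : ∀ ψ ∈ W, ∀ i j, DifferentiableOn ℂ (fun σ => (𝔇.𝒦 Z t).G2 σ (𝔇.uOf Z t ψ) i j) {σ | ∀ j, σ j ∈ Uσ})
    (hGd : ∀ σ : TPt P.d (domCount P M (k + 1)) → ℂ, (∀ j, σ j ∈ Uσ) → ∀ i j, DifferentiableOn ℂ (fun ψ => (𝔇.𝒦 Z t).G2 σ (𝔇.uOf Z t ψ) i j) W)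
    -- THE PRIMITIVE φ-LAW OF THE OLDER-TERMS POTENTIAL AT ZERO FIELD ((1.41) p. 11; [I] p. 263): φ-holomorphic on `W` at each Y
    (h𝒪d0 : ∀ Y, DifferentiableOn ℂ (fun ψ => 𝒪 Z t old ψ Y 0) W)
    {γ₂ a₂₀ w : ℝ}
    (hγ₂ : 0 ≤ γ₂)
    (ha0 : 0 ≤ a₂₀)
    -- bonds located on the torus `UT Nf`
    (hfibN : ∀ x : UT 𝔇.Nf, (Finset.univ.filter fun j => (𝔇.𝒦 Z t).locN j = x).card ≤ (𝔇.𝒦 Z t).m)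
    -- rates and NODE A's kernel letters, UNIFORM on `W`
    {kap kap' kap'' θ θE θΓ θC KG KΓ KCs K₀ : ℝ}
    (hkap'' : 0 < kap'')
    (h1 : kap'' < kap')
    (h2 : kap' < kap)
    (hθE : 0 ≤ θE)
    (hθΓ : 0 ≤ θΓ)
    (hθC : 0 ≤ θC)
    (hKG : 0 ≤ KG)
    (hKΓ : 0 ≤ KΓ)
    (hKCs : 0 ≤ KCs)
    (hK₀ : 0 ≤ K₀)
    (hθEle : θE ≤ θ)
    (hθΓle : θΓ ≤ θ)
    (hθR1le : ((𝔇.𝒦 Z t).m * (1 + 2 / (kap - kap')) ^ 𝔇.ν) * ((𝔇.𝒦 Z t).m * (1 + 2 / (kap' - kap'')) ^ 𝔇.ν)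
      * (θΓ * KCs * KG + KΓ * θC * KG + KΓ * K₀ * θΓ) ≤ θ)
    (hG : ∀ ψ ∈ W, ∀ σ : TPt P.d (domCount P M (k + 1)) → ℂ, (∀ j, σ j ∈ Uσ) →
      ∀ b j, ‖(𝔇.𝒦 Z t).G2 σ (𝔇.uOf Z t ψ) b j‖ ≤ KG * Real.exp (-(kap * tdist1 𝔇.Nf ((𝔇.𝒦 Z t).locΛ b) ((𝔇.𝒦 Z t).locN j))))
    (hΓ₀ : ∀ b j, ‖(𝔇.𝒦 Z t).Γ₀ b j‖ ≤ KΓ * Real.exp (-(kap * tdist1 𝔇.Nf ((𝔇.𝒦 Z t).locΛ b) ((𝔇.𝒦 Z t).locN j))))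
    (hCs : ∀ ψ ∈ W, ∀ σ : TPt P.d (domCount P M (k + 1)) → ℂ, (∀ j, σ j ∈ Uσ) →
      ∀ b b', ‖(𝔇.A Z t ψ σ)⁻¹ b b'‖ ≤ KCs * Real.exp (-(kap * tdist1 𝔇.Nf ((𝔇.𝒦 Z t).locΛ b) ((𝔇.𝒦 Z t).locΛ b'))))
    (hC216 : ∀ b b', ‖(𝔇.𝒦 Z t).C b b'‖ ≤ K₀ * Real.exp (-(kap * tdist1 𝔇.Nf ((𝔇.𝒦 Z t).locΛ b) ((𝔇.𝒦 Z t).locΛ b'))))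
    (hdΓ : ∀ ψ ∈ W, ∀ σ : TPt P.d (domCount P M (k + 1)) → ℂ, (∀ j, σ j ∈ Uσ) →
      ∀ b j, ‖((𝔇.𝒦 Z t).G2 σ (𝔇.uOf Z t ψ) - (𝔇.𝒦 Z t).Γ₀.map (algebraMap ℝ ℂ)) b j‖ ≤ θΓ * Real.exp (-(kap * tdist1 𝔇.Nf ((𝔇.𝒦 Z t).locΛ b) ((𝔇.𝒦 Z t).locN j))))
    (hdC : ∀ ψ ∈ W, ∀ σ : TPt P.d (domCount P M (k + 1)) → ℂ, (∀ j, σ j ∈ Uσ) →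
      ∀ b b', ‖((𝔇.A Z t ψ σ)⁻¹ - (𝔇.𝒦 Z t).C.map (algebraMap ℝ ℂ)) b b'‖
        ≤ θC * Real.exp (-(kap * tdist1 𝔇.Nf ((𝔇.𝒦 Z t).locΛ b) ((𝔇.𝒦 Z t).locΛ b'))))
    (hdE : ∀ ψ ∈ W, ∀ σ : TPt P.d (domCount P M (k + 1)) → ℂ, (∀ j, σ j ∈ Uσ) →
      ∀ b b', ‖(𝔇.A Z t ψ σ - (𝔇.𝒦 Z t).C⁻¹.map (algebraMap ℝ ℂ)) b b'‖ ≤ θE * Real.exp (-(kap * tdist1 𝔇.Nf ((𝔇.𝒦 Z t).locΛ b) ((𝔇.𝒦 Z t).locΛ b'))))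
    (hsmallKθ : K₀ * ((𝔇.𝒦 Z t).m * (1 + 2 / kap) ^ 𝔇.ν) * (θ * ((𝔇.𝒦 Z t).m * (1 + 2 / kap'') ^ 𝔇.ν)) < 1)
    -- the (2.24)–(2.25) smallness
    {cE g : ℝ}
    (hc0 : 0 ≤ cE)
    (hc : ∀ k, (𝔇.𝒦 Z t).hC.1.eigenvalues k ≤ cE)
    (hαc : (2 * (θ * ((𝔇.𝒦 Z t).m * (1 + 2 / kap'') ^ 𝔇.ν)) + (γ₂ + a₂₀)) * cE ≤ 1 / 2)
    (hΓq : ∀ X : (𝔇.𝒦 Z t).Λ ⊕ (𝔇.𝒦 Z t).C₀ → ℝ, ((𝔇.𝒦 Z t).Γ₀ *ᵥ X) ⬝ᵥ ((𝔇.𝒦 Z t).C *ᵥ ((𝔇.𝒦 Z t).Γ₀ *ᵥ X)) ≤ g * (X ⬝ᵥ X))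
    (hsmall : (2 * (θ * ((𝔇.𝒦 Z t).m * (1 + 2 / kap'') ^ 𝔇.ν)) + (γ₂ + a₂₀)) * (1 + 2 * cE * g) ≤ 1 / 2)
    -- the older terms' value at zero field: the (2.20)-type bound on the τ-region, UNIFORM on `W` (Lemma 2 at the background)
    (h220V : ∀ ψ ∈ W, ∀ τ : TDom P.d (L * domCount P M (k + 1)) → ℂ, (∀ Y, τ Y ∈ Uτ Y) →
      ∀ B : (𝔇.𝒦 Z t).Λ → ℝ, ∑ Y ∈ t.1, ‖τ Y‖ * ‖𝒪 Z t old ψ Y 0‖ ≤ a₂₀ / 2 * (B ⬝ᵥ B) + w) :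
    AnalyticOnNhd ℂ (fun ψ : CPair P 𝔸 => term214 𝔇.r (sigmaList L Z t) (tauList P M k L t)
        (core214 (𝔇.A Z t ψ) (𝔇.Gam Z t ψ) (F214 t.2.card (fun _ => (1 : ℝ)) (fun _ => (1 : ℝ)) t.1 (fun Y _ => 𝒪 Z t old ψ Y 0))) 0 0) W := by
  -- (2.22) is free without large-field boxes at `χ = χᶜ = 1`
  have h222V : ∀ B : (𝔇.𝒦 Z t).Λ → ℝ, (fun _ => (1 : ℝ)) B * (fun _ => (1 : ℝ)) B ≤ Real.exp (-(γ₂ / 2 * (0 : ℝ) ^ 2 * (t.2.card : ℕ)) + γ₂ / 2 * (fun B => B ⬝ᵥ B) B) :=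
    fun B => by
      have hB : 0 ≤ B ⬝ᵥ B := Finset.sum_nonneg fun i _ => mul_self_nonneg (B i)
      rw [hP0]
      simp only [Nat.cast_zero, mul_zero, neg_zero, zero_add, one_mul]
      exact Real.one_le_exp (mul_nonneg (by positivity) hB)
  refine analyticOnNhd_of_differentiableOn ?_ hW
  exact differentiableOn_term214_torus_param_of_primitives_holo_polyτ c hW hUσ hUτ hUexp hr hr' hsubτ (lZ := sigmaList L Z t) (sigmaList_spec Z t).1
    (lD := tauList P M k L t) (tauList_spec t).1 (fun ψ σ => 𝔇.A Z t ψ σ) (fun ψ σ X => 𝔇.Gam Z t ψ σ X) t.2.card (fun _ => (1 : ℝ)) (fun _ => (1 : ℝ))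
    (fun _ => zero_le_one) (fun _ => zero_le_one) t.1 (fun ψ Y _ => 𝒪 Z t old ψ Y 0) (𝔇.𝒦 Z t).hC (𝔇.𝒦 Z t).Γ₀ hAhol hAd measurable_const measurable_const
    (fun _ _ _ => measurable_const) (fun Y _ => h𝒪d0 Y) hAs hA (fun ψ σ => (𝔇.𝒦 Z t).G2 σ (𝔇.uOf Z t ψ)) hGhol hGd (fun _ _ _ _ _ => rfl)
    (fun B => B ⬝ᵥ B) h222V hγ₂ (fun _ => le_rfl) ha0 h220V (𝔇.𝒦 Z t).locΛ (𝔇.𝒦 Z t).locN (𝔇.𝒦 Z t).hfib hfibN hkap'' h1 h2 hθE hθΓ hθC hKG hKΓ hKCs hK₀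
    hθEle hθΓle hθR1le hG hΓ₀ hCs hC216 hdΓ hdC hdE hsmallKθ hc0 hc hαc hΓq hsmall

end YMDAG.N22.W1

end
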